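import Summits.QuantumFields.BalabanUV.Beta.GAN24.TorusGaugeDefect
import Literature.MathematicalPhysics.QuantumFieldTheory.Balaban1983to89.Beta.LandauMultiplierIdentities
import Literature.MathematicalPhysics.QuantumFieldTheory.Balaban1983to89.B5DivOrth
import Literature.MathematicalPhysics.QuantumFieldTheory.Balaban1983to89.B5Adjoint130

/-!
# `BalabanUV.Beta.FP.CompositeMinimiserJunction` — road «FP» for binder row D1, row **IR-5′** (`HOME/b2b-balaban-beta-d1-p3/IR5P-STATEMENT.md` §3, FIRST task
# «UNIT BOOKKEEPING»; owner GO journal 2026-08-21T04:56:14Z): **THE FIELD–MULTIPLIER JUNCTION an2 ↔ [B5] ON EVERY TORUS** — the `M`-periodisation of an2's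
# minimiser kernel `wH^{(N)}` (the fm block of the packed resolvent `KInv N`, whose `Q_j`-block means are the fm legs of the road's (j, m)-resolvents
# `KTot (Lc^(j+m)) (Lc^j) = dec (Lc^j) (KInv (Lc^(j+m)))`) IS `N^{−(d+2)}` times Bałaban's minimiser `H_k = G_kQ_k^*(Q_kG_kQ_k^*)⁻¹` ((1.60)∕(1.103) of
# [Balaban1984PropagatorsI]) as typed by b05 (`Beta.FluctuationProjection.Hk`):  `Σ_{t∈ℤ^{d+1}} wH κ l (x − N•q + (NM)•t) = N^{−(d+2)} · H_k((x mod NM, κ), (q mod M, l))`,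
# every `N ≥ 1`, every torus `M`, every `d`; the unit `N^{−(d+2)} = η^{D+1}` (`D = d+1` = print's dimension) is EXACTLY the weight of ONE contour bond in (1.11)∕(1.18)
# — an2's constraint `𝒬` is the UNNORMALISED block∘contour sum, whose normalised mean is `OneStepKernelFamily.dec`'s `legW = M^{−(D+1)}` (`sum_legW`)

NOT IN PRINT; OUR PROOF.  HONEST FRAMING (cell contract, verbatim): «discharging `BetaPertH` makes Bałaban's UV stability UNCONDITIONAL — a real constructive-QFT
result; it is NOT the continuum limit and NOT the Clay problem.»  HONEST DEPENDENCY (verbatim): «continuum YM on T⁴ ⇐ BetaPertH ∧ nine spine estimates (0/9 proved);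
BetaPertH ⇐ (D1) ∧ (D4) ∧ CAP+tail; G-an2-4 gates asym, D1 and NE2/3/4.»  THIS MODULE proves NO estimate, instantiates NO wall binder, defines nothing, cites nothing as a
hypothesis (the printed (1.110) `B5.Prop12Printed` is NOT touched — it enters row IR-5′'s INSTANCE file later, as a hypothesis); finite-dimensional linear algebra and
absolutely convergent period sums over the two lineages' OWN typed objects BY NAME; 0 sorry.  NOT IR-5′'s letters (F)∕(N)∕(I), NOT the ff block, NOT hbook, NOT D1, NOT
BetaPertH, NOT continuum, NOT Clay.

ABSOLUTE RULE (cell charter, verbatim): «No internally-minted statement may enter as a cited fact. Every hypothesis is either kernel-proved in this package or a verbatim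
quotation of a PUBLISHED theorem with page reference. The manuscript(s) under audit are NOT citable for their own disputed steps — they are the thing under adjudication;
programme-internal (2001/route/tribunal) claims are never citable.»

WHY (the located gap this closes).  gan24-leaf-18's S6 dictionary proved the junction for the MULTIPLIER–MULTIPLIER block (`GAN24/TorusJunction.tsum_wΦ_pshift_eq_DelK`,
`GAN24/MultiplierDictionary.wΦ_eq_deltaZ`; road FP's (j, m) reading `FP/ConvergenceJMMultiplier`) and, for the minimiser COLUMNS, only «same curvature»
(`GAN24/TorusGaugeDefect.curl_colA_eq_curl_colB`), recording «the fields themselves differing by the two lineages' GAUGE CHOICES (an2: weak block-Landau rows; b05: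
`R∂*A = 0`) inside `ker Q_k ∩ ker ∂`».  THEY DO NOT DIFFER: an2's gauge ROWS «`δdδA` is constant on every `N`-block» (`Beta/BlochFibreMatrix` G rows, the column identity
`KernelSpecInstance.wH_G`) say that the Laplacian of the divergence is block-constant, i.e. lies in `Q′ᴴ(unit lattice)`, which is precisely the range statement
`P(∂*A) = ∂*A` for the projection `P = Δ⁻¹Q′*(Q′Δ⁻²Q′*)⁻¹Q′Δ⁻¹` of (1.26)∕(1.70) (b05's mechanism `LandauMultiplierIdentities.PcT_eq_self_of_LapS_eq`), i.e. Bałaban's slice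
`R∂*A = 0` of (1.47)–(1.49).  With the constraint (`QvOp_colA`), the curl (`curl_colA_sub_colB`) and the slice agreeing, `Δ_a(colA − colB) = 0` for the POSITIVE operator `Δ_a`
of (1.69) (`Kop = ½∂ᴴ∂ + ∇(1−P)∇ᴴ`, `B5DeltaA169.isUnit_DeltaA`), so the columns are EQUAL.  Organisation γ of road FP (R-FP-24) sources its leg letters from (1.110) applied to
`G_k`, `H_k = G_kQ*(QGQ*)⁻¹`; after this file the fm legs of the road's objects are `H_k`-columns with the unit DISPLAYED — no reading is left on them (the ff legs keep one:
an2's hard-gauge covariance `Γ_N` vs b05's `Cov` (1.107), same mechanism on the force columns; not here).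

CONTENT (every `d`, `N ≥ 1`, torus `M : Fin (d+1) → ℕ`, dummy `a > 0` — `Hk` is `a`-free, `FluctuationProjection.Hk_indep`):
* §1 (an2's side, `ℤ^{d+1}`) `codiff₁_trans1`, `dz_trans0`, `gauge_trans1` (the stencil `δdδ` commutes with translations), `gauge_Hcol`, **`gauge_Hper`** (`wH_G` survives the
  periodisation `GAN24/TorusPeriodise.Hper`: `δdδ(ℋ^per_{(l,q)})(N•y + b) = δdδ(ℋ^per_{(l,q)})(N•y)`, `b ∈ box`).
* §2 (bridges to b05's torus matrices `B5Action121`) `periodic_codiff₁`, `periodic_dz`, **`divS_av`** (`∂*·(av A) = c·av(δA)`), **`LapS_liftT`** (`Δ_c (f∘lift) = c²·(δdf)∘lift`).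
* §3 **`LapS_divS_colA_bpt`** (block-constancy of `Δ∂*(colA b)` on the torus), **`R_divS_colA : (1 − P)·∂*(colA b) = 0`** — an2's periodised minimiser column lies on Bałaban's
  hyperplane `{R∂*A = 0}` (`PcT_eq_self_of_LapS_eq`, `B5DivOrth.sum_divS`∕`sum_LapS`).
* §4 **`DeltaA_mulVec_colA_sub_colB`** (`Δ_a(colA b − colB b) = 0`), **`colA_eq_colB`**, **`colA_apply_eq_Hk`** (`colA b i = N^{−(d+2)}·H_k i b`).
* §5 in an2's letters **`tsum_wH_pshift_eq_Hk`** (displayed above) — the fm twin of `TorusJunction.tsum_wΦ_pshift_eq_DelK` (mm, unit `2·N^{−(d+5)}`) — and **`Hk_apply_im`**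
  (the (1.103) matrix is REAL, read off the real kernel `wH`).
Orientation only (nothing used as a hypothesis): [Balaban1984PropagatorsI] = T. Bałaban, Commun. Math. Phys. 95 (1984) 17–40, (1.18) p. 20 (weight `η^{d+1}`), (1.26)∕(1.70)
pp. 22∕30 (`P`), (1.47)–(1.49) p. 26 («minimizing the form ½⟨∂A,∂A⟩ under the conditions Q_kA = B, R∂*A = 0»), (1.60) p. 28, (1.69) p. 29, (1.103) p. 34.
Provenance: D1 formalisation swarm, unit `b2b-balaban-beta-d1-formalise-leaf-05` gen 15, 2026-08-21; road-FP owner d1-p3 GO «leaf-05: IR-5′ UNIT BOOKKEEPING».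
-/

open Finset
open scoped BigOperators ComplexConjugate Matrix

namespace Summit.QuantumFields.BalabanUV.Beta.FP.CompositeMinimiserJunction

open Literature.MathematicalPhysics.QuantumFieldTheory
open Literature.MathematicalPhysics.QuantumFieldTheory.Balaban1983to89
open Literature.MathematicalPhysics.QuantumFieldTheory.Balaban1983to89.Beta
open AffineAveraging (Site Form0 Form1 dz codiff₁ box toSite)
open AffineReproduction (trans0 trans1 trans0_apply trans1_apply)
open B5Prop11Plancherel (Tor fine)
open B5Block118 (QvOp QsOp bpt)
open B5Blocks16 (blockOf)
open B5Action121 (CurlOp GradOp LapS divS LapS_mulVec divS_apply GradOp_conjTranspose_mulVec_eq)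
open B5Value126 (PcT)
open B5DeltaA169 (DeltaA QvAdj isUnit_DeltaA)
open B5DivOrth (sum_divS sum_LapS)
open B5Adjoint130 (QsOp_adjoint_mulVec)
open LandauMultiplierIdentities (PcT_eq_self_of_LapS_eq)
open FluctuationProjection (Hk R_div_Hk_mulVec digitOf bpt_blockOf_digitOf)
open BlockEffectiveAction (Kop DeltaA_eq_Kop_add)
open KernelSpecInstance (wH wH_G hasSum_codiff₁ hasSum_dz)
open ResolventComposition (Hcol Hcol_apply)
open Summit.QuantumFields.BalabanUV.Beta.GAN24.TorusAvatar (toTor liftT Periodic av av_apply av_toTor av_sub_unitVec toTor_liftT toTor_add toTor_sub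
  toTor_unitVec toTor_bpt blockEquiv)
open Summit.QuantumFields.BalabanUV.Beta.GAN24.TorusPeriodise (pshift Hper hasSum_Hper periodic_Hper Hcol_sub_pshift)
open Summit.QuantumFields.BalabanUV.Beta.GAN24.TorusJunction (colA colB)
open Summit.QuantumFields.BalabanUV.Beta.GAN24.TorusGaugeDefect (curl_colA_sub_colB QvOp_colA_sub_colB)

noncomputable section

/-! ## §1 an2's side: the gauge stencil `δdδ` commutes with translations; the G rows survive periodisation -/

section An2

variable {D : ℕ}

/-- [folklore] `δ` commutes with translations: `δ(A ∘ τ_a) = (δA) ∘ τ_a`. -/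
theorem codiff₁_trans1 (a : Site D) (A : Form1 D ℝ) : codiff₁ (trans1 a A) = trans0 a (codiff₁ A) := by
  funext x
  simp only [codiff₁, trans1_apply, trans0_apply]
  refine Finset.sum_congr rfl fun κ _ => ?_
  rw [sub_add_eq_add_sub]

/-- [folklore] `d` commutes with translations: `d(f ∘ τ_a) = (df) ∘ τ_a`. -/
theorem dz_trans0 (a : Site D) (f : Form0 D ℝ) : dz (trans0 a f) = trans1 a (dz f) := by
  funext κ x
  simp only [dz, trans0_apply, trans1_apply]
  rw [add_right_comm]

/-- [folklore] THE GAUGE STENCIL COMMUTES WITH TRANSLATIONS: `δdδ(A ∘ τ_a) = (δdδA) ∘ τ_a`. -/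
theorem gauge_trans1 (a : Site D) (A : Form1 D ℝ) :
    codiff₁ (dz (codiff₁ (trans1 a A))) = trans0 a (codiff₁ (dz (codiff₁ A))) := by
  rw [codiff₁_trans1, dz_trans0, codiff₁_trans1]

variable {d : ℕ} {N : ℕ} [NeZero N]

/-- [folklore] THE G ROW OF A TRANSLATED MINIMISER COLUMN: `δdδ(ℋ_{(l,q)})` is constant on every `N`-block (`KernelSpecInstance.wH_G` BY NAME, translated by `N•q`). -/
theorem gauge_Hcol (l : Fin (d + 1)) (q y : Site (d + 1)) {b : Fin (d + 1) → ℕ} (hb : b ∈ box (d + 1) N) :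
    codiff₁ (dz (codiff₁ (Hcol (N := N) l q))) ((N : ℤ) • y + toSite b) = codiff₁ (dz (codiff₁ (Hcol (N := N) l q))) ((N : ℤ) • y) := by
  have e : Hcol (N := N) l q = trans1 (-((N : ℤ) • q)) (fun κ z => wH (N := N) κ l z) := by
    funext κ z
    rw [Hcol_apply, trans1_apply, sub_eq_add_neg]
  have e1 : (N : ℤ) • y + toSite b + -((N : ℤ) • q) = (N : ℤ) • (y - q) + toSite b := by
    rw [smul_sub]; abel
  have e2 : (N : ℤ) • y + -((N : ℤ) • q) = (N : ℤ) • (y - q) := by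
    rw [smul_sub]; abel
  rw [e, gauge_trans1, trans0_apply, trans0_apply, e1, e2]
  exact wH_G l (y - q) hb

variable (N) (M : Fin (d + 1) → ℕ) [∀ ν, NeZero (M ν)]

/-- **THE G ROWS SURVIVE PERIODISATION**: the gauge quantity `δdδ(ℋ^per_{(l,q)})` of the `M`-periodised minimiser column (`GAN24/TorusPeriodise.Hper`) is constant
on every `N`-block of `ℤ^{d+1}` (the finite stencil commutes with the absolutely convergent period sums, `hasSum_codiff₁`∕`hasSum_dz`; `gauge_Hcol` term by term). -/
theorem gauge_Hper (l : Fin (d + 1)) (q y : Site (d + 1)) {b : Fin (d + 1) → ℕ} (hb : b ∈ box (d + 1) N) :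
    codiff₁ (dz (codiff₁ (Hper N M l q))) ((N : ℤ) • y + toSite b) = codiff₁ (dz (codiff₁ (Hper N M l q))) ((N : ℤ) • y) := by
  have h1 : ∀ x, HasSum (fun t : Site (d + 1) => codiff₁ (Hcol (N := N) l (q - pshift M t)) x) (codiff₁ (Hper N M l q) x) :=
    fun x => hasSum_codiff₁ (fun κ x' => hasSum_Hper N M l q κ x') x
  have h2 : ∀ κ x, HasSum (fun t : Site (d + 1) => dz (codiff₁ (Hcol (N := N) l (q - pshift M t))) κ x)
      (dz (codiff₁ (Hper N M l q)) κ x) := fun κ x => hasSum_dz h1 κ x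
  have h3 : ∀ x, HasSum (fun t : Site (d + 1) => codiff₁ (dz (codiff₁ (Hcol (N := N) l (q - pshift M t)))) x)
      (codiff₁ (dz (codiff₁ (Hper N M l q))) x) := fun x => hasSum_codiff₁ h2 x
  have e : (fun t : Site (d + 1) => codiff₁ (dz (codiff₁ (Hcol (N := N) l (q - pshift M t)))) ((N : ℤ) • y + toSite b))
      = fun t => codiff₁ (dz (codiff₁ (Hcol (N := N) l (q - pshift M t)))) ((N : ℤ) • y) := by
    funext t; exact gauge_Hcol l _ y hb
  have h4 := h3 ((N : ℤ) • y + toSite b)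
  rw [e] at h4
  exact h4.unique (h3 _)

end An2

/-! ## §2 Bridges: b05's divergence and scalar Laplacian on torus avatars are an2's `δ` and `δd` at the lift -/

section Bridges

variable {D : ℕ} {P : Fin D → ℕ}

/-- [folklore] The divergence of a periodic 1-form is periodic. -/
theorem periodic_codiff₁ {A : Form1 D ℝ} (hA : ∀ κ, Periodic P (A κ)) : Periodic P (codiff₁ A) := by
  intro x ν
  simp only [codiff₁]
  refine Finset.sum_congr rfl fun κ _ => ?_
  rw [add_sub_right_comm, hA κ (x - AffineAveraging.unitVec κ) ν, hA κ x ν]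

/-- [folklore] The gradient of a periodic scalar is periodic. -/
theorem periodic_dz {f : Form0 D ℝ} (hf : Periodic P f) (κ : Fin D) : Periodic P (dz f κ) := by
  intro x ν
  simp only [dz]
  rw [add_right_comm, hf (x + AffineAveraging.unitVec κ) ν, hf x ν]

variable [∀ ν, NeZero (P ν)]

/-- **THE DIVERGENCE BRIDGE**: b05's `∂*` (lattice factor `c`, `B5Action121.divS`) of the avatar of a periodic 1-form is `c` times the avatar of an2's `δ`:
`(∂*_c (av A))(z) = c · (δA)(lift z)` (the two four-point stencils coincide, sign included). -/
theorem divS_av (c : ℕ) {A : Form1 D ℝ} (hA : ∀ κ, Periodic P (A κ)) (z : Tor P) :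
    divS P (c : ℂ) (av A) z = (c : ℂ) * ((codiff₁ A (liftT z) : ℝ) : ℂ) := by
  rw [divS_apply]
  simp only [codiff₁, Complex.ofReal_sum, Complex.ofReal_sub, Finset.mul_sum, map_natCast]
  refine Finset.sum_congr rfl fun μ _ => ?_
  rw [av_sub_unitVec hA, av_apply]

/-- **THE LAPLACIAN BRIDGE**: b05's scalar Laplacian `Δ_c = Σ_ν ∇_ν^*∇_ν` (`B5Action121.LapS`) of the avatar of a periodic scalar is `c²` times the avatar of an2's `δd`:
`(Δ_c (f ∘ lift))(z) = c² · (δdf)(lift z)`. -/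
theorem LapS_liftT (c : ℕ) {f : Form0 D ℝ} (hf : Periodic P f) (z : Tor P) :
    (LapS P (c : ℂ) *ᵥ fun w => ((f (liftT w) : ℝ) : ℂ)) z = ((c : ℂ) * (c : ℂ)) * ((codiff₁ (dz f) (liftT z) : ℝ) : ℂ) := by
  rw [LapS_mulVec]
  have hp : ∀ ν, f (liftT (z + B5Prop11Plancherel.unitVec P ν)) = f (liftT z + AffineAveraging.unitVec ν) := fun ν =>
    hf.apply_liftT (by rw [toTor_add, toTor_liftT, toTor_unitVec])
  have hm : ∀ ν, f (liftT (z - B5Prop11Plancherel.unitVec P ν)) = f (liftT z - AffineAveraging.unitVec ν) := fun ν =>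
    hf.apply_liftT (by rw [toTor_sub, toTor_liftT, toTor_unitVec])
  simp only [hp, hm, codiff₁, dz, sub_add_cancel, Complex.ofReal_sum, Complex.ofReal_sub, Finset.mul_sum, map_natCast]
  refine Finset.sum_congr rfl fun ν _ => ?_
  ring

end Bridges

/-! ## §3 an2's torus column lies on Bałaban's hyperplane `{R∂*A = 0}` -/

section Slice

variable {d : ℕ} (N : ℕ) [NeZero N] (M : Fin (d + 1) → ℕ) [∀ ν, NeZero (M ν)]

/-- The divergence of an2's torus column `colA b = av ℋ^per_b` in closed form: `∂*_N(colA b) = N · av(δℋ^per_b)`. -/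
theorem divS_colA (b : Tor M × Fin (d + 1)) :
    divS (fine N M) (N : ℂ) (colA N M b) = fun z => (N : ℂ) * ((codiff₁ (Hper N M b.2 (liftT b.1)) (liftT z) : ℝ) : ℂ) := by
  funext z
  rw [colA, divS_av N (periodic_Hper N M b.2 (liftT b.1))]

/-- **`Δ∂*(colA b)` IS CONSTANT ON EVERY BLOCK OF THE TORUS** (an2's G rows, `gauge_Hper`, through the bridges): its value at the block point `N•ȳ + j` is
`N³ · (δdδ ℋ^per_b)(N • lift ȳ)`, independent of the offset `j`. -/
theorem LapS_divS_colA_bpt (b : Tor M × Fin (d + 1)) (y : Tor M) (j : Fin (d + 1) → Fin N) :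
    (LapS (fine N M) (N : ℂ) *ᵥ divS (fine N M) (N : ℂ) (colA N M b)) (bpt N M y j)
      = (N : ℂ) * ((N : ℂ) * (N : ℂ)) * ((codiff₁ (dz (codiff₁ (Hper N M b.2 (liftT b.1)))) ((N : ℤ) • liftT y) : ℝ) : ℂ) := by
  have hper : ∀ κ, Periodic (fine N M) (Hper N M b.2 (liftT b.1) κ) := periodic_Hper N M b.2 (liftT b.1)
  have hf : Periodic (fine N M) (codiff₁ (Hper N M b.2 (liftT b.1))) := periodic_codiff₁ hper
  have hG : Periodic (fine N M) (codiff₁ (dz (codiff₁ (Hper N M b.2 (liftT b.1))))) := periodic_codiff₁ fun κ => periodic_dz hf κ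
  have e : divS (fine N M) (N : ℂ) (colA N M b) = (N : ℂ) • fun z => ((codiff₁ (Hper N M b.2 (liftT b.1)) (liftT z) : ℝ) : ℂ) := by
    funext z
    rw [divS_colA, Pi.smul_apply, smul_eq_mul]
  have hb : (fun i => (j i : ℕ)) ∈ box (d + 1) N := Fintype.mem_piFinset.2 fun i => Finset.mem_range.2 (j i).isLt
  rw [e, Matrix.mulVec_smul, Pi.smul_apply, smul_eq_mul, LapS_liftT N hf, hG.apply_liftT (toTor_bpt N M y j),
    gauge_Hper N M b.2 (liftT b.1) (liftT y) hb]
  ring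

/-- **an2's TORUS COLUMN LIES ON BAŁABAN's HYPERPLANE**: `(1 − P)·∂*(colA b) = 0`, i.e. `R∂*(colA b) = 0` with `R = 1 − P`, `P` the projection (1.26)∕(1.70) — the weak
block-Landau gauge rows of an2's typed system ARE the slice of (1.47) (`LandauMultiplierIdentities.PcT_eq_self_of_LapS_eq`: a mean-zero scalar whose Laplacian is
block-constant with mean-zero block values lies in the range of `P`). -/
theorem R_divS_colA (b : Tor M × Fin (d + 1)) :
    (1 - PcT N M (N : ℂ)) *ᵥ ((GradOp (fine N M) (N : ℂ))ᴴ *ᵥ colA N M b) = 0 := by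
  set u : Tor (fine N M) → ℂ := divS (fine N M) (N : ℂ) (colA N M b) with hu_def
  -- the block values of `Δu`
  set V : Tor M → ℂ := fun y => (N : ℂ) * ((N : ℂ) * (N : ℂ)) *
    ((codiff₁ (dz (codiff₁ (Hper N M b.2 (liftT b.1)))) ((N : ℤ) • liftT y) : ℝ) : ℂ) with hV_def
  have hblk : ∀ x, (LapS (fine N M) (N : ℂ) *ᵥ u) x = V (blockOf N M x) := by
    intro x
    conv_lhs => rw [← bpt_blockOf_digitOf N M x]
    exact LapS_divS_colA_bpt N M b _ _
  set g : Tor M → ℂ := fun y => (N : ℂ) ^ (d + 1) * V y with hg_def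
  have hNc : ((N : ℂ) ^ (d + 1)) ≠ 0 := pow_ne_zero _ (Nat.cast_ne_zero.2 (NeZero.ne N))
  have h : LapS (fine N M) (N : ℂ) *ᵥ u = (QsOp N M)ᴴ *ᵥ g := by
    funext x
    rw [hblk, QsOp_adjoint_mulVec, hg_def]
    field_simp
  have hu : ∑ x, u x = 0 := sum_divS (fine N M) (N : ℂ) (colA N M b)
  have hsumV : ∑ x, (LapS (fine N M) (N : ℂ) *ᵥ u) x = ∑ y, (N : ℂ) ^ (d + 1) * V y := by
    rw [← Fintype.sum_equiv (blockEquiv N M) (fun p => (LapS (fine N M) (N : ℂ) *ᵥ u) (bpt N M p.1 p.2))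
      (fun x => (LapS (fine N M) (N : ℂ) *ᵥ u) x) (fun p => rfl), Fintype.sum_prod_type]
    refine Finset.sum_congr rfl fun y _ => ?_
    have : ∀ j : Fin (d + 1) → Fin N, (LapS (fine N M) (N : ℂ) *ᵥ u) (bpt N M y j) = V y := fun j => by
      rw [hblk, B5Blocks16.blockOf_bpt]
    simp only [this, Finset.sum_const, Finset.card_univ, Fintype.card_pi, Fintype.card_fin, Finset.prod_const, nsmul_eq_mul]
    push_cast
    ring
  have hg : ∑ y, g y = 0 := by
    rw [hg_def]
    show ∑ y, (N : ℂ) ^ (d + 1) * V y = 0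
    rw [← hsumV]
    exact sum_LapS (fine N M) (N : ℂ) u
  have hP := PcT_eq_self_of_LapS_eq N M u g hu hg h
  rw [Matrix.sub_mulVec, Matrix.one_mulVec, GradOp_conjTranspose_mulVec_eq, ← hu_def, hP, sub_self]

end Slice

/-! ## §4 The two columns are EQUAL: `Δ_a(colA − colB) = 0` for the positive operator `Δ_a` -/

section Equal

variable {d : ℕ} (N : ℕ) [NeZero N] (hN : 1 ≤ N) (M : Fin (d + 1) → ℕ) [∀ ν, NeZero (M ν)] (a : ℝ) (ha : 0 < a)

/-- **`Δ_a(colA b − colB b) = 0`**: `Δ_a = ½∂ᴴ∂ + ∇(1−P)∇ᴴ + aQ*Q` (`BlockEffectiveAction.Kop`, (1.69)) and the difference of the two columns has zero curl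
(`TorusGaugeDefect.curl_colA_sub_colB`), zero block averages (`QvOp_colA_sub_colB`) and lies on the slice (§3 and `FluctuationProjection.R_div_Hk_mulVec`). -/
theorem DeltaA_mulVec_colA_sub_colB (b : Tor M × Fin (d + 1)) :
    DeltaA N M a *ᵥ (colA N M b - colB N hN M a ha b) = 0 := by
  have hC := curl_colA_sub_colB N hN M a ha b
  have hQ := QvOp_colA_sub_colB N hN M a ha b
  have hR : (1 - PcT N M (N : ℂ)) *ᵥ ((GradOp (fine N M) (N : ℂ))ᴴ *ᵥ (colA N M b - colB N hN M a ha b)) = 0 := by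
    rw [Matrix.mulVec_sub, Matrix.mulVec_sub, R_divS_colA, colB, R_div_Hk_mulVec, sub_zero]
  rw [DeltaA_eq_Kop_add, Kop, Matrix.add_mulVec, Matrix.add_mulVec, Matrix.smul_mulVec, ← Matrix.mulVec_mulVec, hC,
    Matrix.mulVec_zero, smul_zero, zero_add, ← Matrix.mulVec_mulVec, ← Matrix.mulVec_mulVec, hR, Matrix.mulVec_zero, zero_add,
    Matrix.smul_mulVec, ← Matrix.mulVec_mulVec, hQ, Matrix.mulVec_zero, smul_zero]

/-- **THE COLUMNS ARE EQUAL**: an2's periodised minimiser column on the torus IS b05's `H_k` applied to the same datum `N^{−(d+2)} e_b` — for every dummy `a > 0`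
(`Δ_a` is invertible, `B5DeltaA169.isUnit_DeltaA`). -/
theorem colA_eq_colB (b : Tor M × Fin (d + 1)) : colA N M b = colB N hN M a ha b := by
  have hdet : (DeltaA N M a).det ≠ 0 :=
    ((Matrix.isUnit_iff_isUnit_det _).mp (isUnit_DeltaA N hN M a ha)).ne_zero
  exact sub_eq_zero.mp (Matrix.eq_zero_of_mulVec_eq_zero hdet (DeltaA_mulVec_colA_sub_colB N hN M a ha b))

/-- **ENTRYWISE**: `colA b i = N^{−(d+2)} · H_k i b` — an2's periodised minimiser kernel, read on the torus, is the `(i, b)` entry of Bałaban's (1.103) matrix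
times the weight of one contour bond in (1.18). -/
theorem colA_apply_eq_Hk (b : Tor M × Fin (d + 1)) (i : Tor (fine N M) × Fin (d + 1)) :
    colA N M b i = ((N : ℂ) ^ (d + 2))⁻¹ * Hk N hN M a ha i b := by
  rw [colA_eq_colB N hN M a ha, colB, Matrix.mulVec_smul, Pi.smul_apply, smul_eq_mul, Matrix.mulVec_single_one, Matrix.col_apply]

end Equal

/-! ## §5 In an2's letters: the periodised minimiser kernel `wH^{(N)}` IS `N^{−(d+2)}·H_k`; the (1.103) matrix is real -/

section Letters

variable {d : ℕ} (N : ℕ) [NeZero N] (hN : 1 ≤ N) (M : Fin (d + 1) → ℕ) [∀ ν, NeZero (M ν)] (a : ℝ) (ha : 0 < a)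

/-- **THE FIELD–MULTIPLIER JUNCTION an2 ↔ [B5]** (the fm twin of `GAN24/TorusJunction.tsum_wΦ_pshift_eq_DelK`): for every fine point `x ∈ ℤ^{d+1}`, every
coarse torus bond `(ȳ, l)` and fine direction `κ`,
`Σ_{t ∈ ℤ^{d+1}} wH κ l (x − N•lift ȳ + (NM)•t) = N^{−(d+2)} · H_k((x mod NM, κ), (ȳ, l))` — the `M`-periodisation of an2's minimiser kernel (response of the fine
field to a unit UNNORMALISED block∘contour sum prescribed at the coarse bond) is Bałaban's minimiser `H_k = G_kQ*(QGQ*)⁻¹` applied to the normalised datum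
`N^{−(d+2)} e_{(ȳ,l)}`; `N^{−(d+2)}` = the weight `η^{d+1}` of ONE bond in (1.18) (`OneStepKernelFamily.legW`∕`sum_legW` on the road's side). -/
theorem tsum_wH_pshift_eq_Hk (κ l : Fin (d + 1)) (y : Tor M) (x : Site (d + 1)) :
    (((∑' t : Site (d + 1), wH (N := N) κ l (x - (N : ℤ) • liftT y + pshift (fine N M) t)) : ℝ) : ℂ)
      = ((N : ℂ) ^ (d + 2))⁻¹ * Hk N hN M a ha (toTor (fine N M) x, κ) (y, l) := by
  have e : (((∑' t : Site (d + 1), wH (N := N) κ l (x - (N : ℤ) • liftT y + pshift (fine N M) t)) : ℝ) : ℂ)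
      = colA N M (y, l) (toTor (fine N M) x, κ) := by
    rw [colA, av_toTor (periodic_Hper N M l (liftT y))]
    simp only [Hper, Hcol_sub_pshift]
  rw [e, colA_apply_eq_Hk N hN M a ha]

/-- **THE (1.103) MATRIX IS REAL**: every entry of b05's `H_k` has zero imaginary part (it is `N^{d+2}` times a value of an2's real kernel `ℋ^per`). -/
theorem Hk_apply_im (i : Tor (fine N M) × Fin (d + 1)) (b : Tor M × Fin (d + 1)) : (Hk N hN M a ha i b).im = 0 := by
  have hNc : ((N : ℂ) ^ (d + 2)) ≠ 0 := pow_ne_zero _ (Nat.cast_ne_zero.2 (NeZero.ne N))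
  have h := colA_apply_eq_Hk N hN M a ha b i
  rw [colA, av_apply] at h
  have e : Hk N hN M a ha i b = (N : ℂ) ^ (d + 2) * ((Hper N M b.2 (liftT b.1) i.2 (liftT i.1) : ℝ) : ℂ) := by
    rw [h, ← mul_assoc, mul_inv_cancel₀ hNc, one_mul]
  rw [e, show ((N : ℂ) ^ (d + 2)) = (((N : ℝ) ^ (d + 2) : ℝ) : ℂ) by push_cast; rfl, ← Complex.ofReal_mul, Complex.ofReal_im]

end Letters

end

end Summit.QuantumFields.BalabanUV.Beta.FP.CompositeMinimiserJunction
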